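import Summits.CriticalPhenomena.PercolationContinuityZ3.Theorems.PercNearOneGluingNoHeavyLowerTailChampionStability
import Summits.CriticalPhenomena.PercolationContinuityZ3.Theorems.PercNearOneGluingNoHeavyLowerTailCILFour
import Summits.CriticalPhenomena.PercolationContinuityZ3.Theorems.PercNearOneGluingNoHeavyLowerTailCILBlobsCoLight
import HarnessLib

/-!
# `NoHeavyLowerTail` (stmt-CriticalPhenomena-4575) — champion stability, LOCAL form: one relay set and one level at a time

Seat `prim-gen-swap`, 2026-08-18.  The reductions `CS₂ ⇒ MS ⇒ CIL` of `…MergeStability` / `…ChampionStability` take the champion-stability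
hypothesis for ALL graphs; but the induction (on the positive pairs at the observer, for a FIXED vertex type `Fin n`, relay set `A` and
level `j`) only ever uses it for the same `n, A, j`.  This file records the local forms:

* `cumulativeIsolation_of_mergeStability_at` — MS for `(n, A, j)` (all weights, observers, glued vertices, champions) ⇒ CIL_j for `A`;
* `mergeStability_of_championStabilityPair_at`, `cumulativeIsolation_of_championStabilityPair_at` — the same from CS₂ for `(n, A, j)`;
* `cumulativeIsolation_card_five_of_championStabilityPair` — **the |A| = 5 rung**: CS₂ for a five-element relay set at level `2` gives CIL
  for that set at EVERY level (levels `0, 1, ≥ 3` are in the tree: `cumulativeIsolation_level_one`,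
  `cumulativeIsolation_level_ge_card_sub_two`), i.e. exactly `stub_cumulativeIsolation` restricted to `A.card = 5`.
So the first open rung of the one-cut / CIL line is precisely: CS₂ for `|A| = 5`, `j = 2` (a statement about one weighted graph, two
vertices `x, y`, and the level-2 champion among five relays).
-/

noncomputable section

namespace Summit.CriticalPhenomena.PercolationContinuityZ3.Theorems

open MeasureTheory Set Literature.Probability.LatticeModels Literature.Probability.Percolation
open scoped Classical BigOperators

variable {n : ℕ}

open MergeStability in
/-- **MS for one `(n, A, j)` ⇒ CIL_j for `A`.**  Same induction as `cumulativeIsolation_of_mergeStability`. -/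
theorem cumulativeIsolation_of_mergeStability_at (A : Finset (Fin n)) (j : ℕ)
    (hMS : ∀ (w : Sym2 (Fin n) → unitInterval) (o v aStar : Fin n),
      o ∉ A → v ≠ o → aStar ∈ A → w s(o, v) = 0 →
      (∀ a ∈ A,
        (Literature.Probability.LatticeModels.prodBernoulli w).real {ω : Literature.Probability.Percolation.BondConfig (Fin n) | (A.filter fun x => ω ∈ Literature.Probability.Percolation.openConn a x).card ≤ j} ≤
          (Literature.Probability.LatticeModels.prodBernoulli w).real {ω : Literature.Probability.Percolation.BondConfig (Fin n) | (A.filter fun x => ω ∈ Literature.Probability.Percolation.openConn aStar x).card ≤ j}) →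
      (Literature.Probability.LatticeModels.prodBernoulli (Function.update w s(o, v) 1)).real {ω : Literature.Probability.Percolation.BondConfig (Fin n) |
            1 ≤ (A.filter fun x => ω ∈ Literature.Probability.Percolation.openConn o x).card ∧ (A.filter fun x => ω ∈ Literature.Probability.Percolation.openConn o x).card ≤ j} ≤
        (Literature.Probability.LatticeModels.prodBernoulli (Function.update w s(o, v) 1)).real {ω : Literature.Probability.Percolation.BondConfig (Fin n) |
            (A.filter fun x => ω ∈ Literature.Probability.Percolation.openConn aStar x).card ≤ j}) :
    ∀ (w : Sym2 (Fin n) → unitInterval) (o : Fin n), A.Nonempty → o ∉ A → ∃ a ∈ A,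
        (Literature.Probability.LatticeModels.prodBernoulli w).real {ω : Literature.Probability.Percolation.BondConfig (Fin n) |
              1 ≤ (A.filter fun x => ω ∈ Literature.Probability.Percolation.openConn o x).card ∧ (A.filter fun x => ω ∈ Literature.Probability.Percolation.openConn o x).card ≤ j} ≤
          (Literature.Probability.LatticeModels.prodBernoulli w).real {ω : Literature.Probability.Percolation.BondConfig (Fin n) | (A.filter fun x => ω ∈ Literature.Probability.Percolation.openConn a x).card ≤ j} := by
  intro w o hA ho
  -- induction on the number of positive-weight pairs at `o`
  suffices H : ∀ (m : ℕ) (w : Sym2 (Fin n) → unitInterval),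
      (Finset.univ.filter fun v : Fin n => v ≠ o ∧ 0 < (w s(o, v) : ℝ)).card = m →
      ∃ a ∈ A, (prodBernoulli w).real {ω : BondConfig (Fin n) |
          1 ≤ (A.filter fun x => ω ∈ openConn o x).card ∧ (A.filter fun x => ω ∈ openConn o x).card ≤ j} ≤
        (prodBernoulli w).real {ω : BondConfig (Fin n) | (A.filter fun x => ω ∈ openConn a x).card ≤ j} from
    H _ w rfl
  intro m
  induction m with
  | zero =>
    intro w hm
    obtain ⟨a, ha⟩ := hA
    refine ⟨a, ha, ?_⟩
    have hw : ∀ v : Fin n, v ≠ o → (w s(o, v) : ℝ) = 0 := by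
      intro v hv
      by_contra hne
      have hpos : 0 < (w s(o, v) : ℝ) := lt_of_le_of_ne (w s(o, v)).2.1 (Ne.symm hne)
      have hmem : v ∈ (Finset.univ.filter fun v : Fin n => v ≠ o ∧ 0 < (w s(o, v) : ℝ)) :=
        Finset.mem_filter.2 ⟨Finset.mem_univ _, hv, hpos⟩
      rw [Finset.card_eq_zero] at hm
      rw [hm] at hmem
      exact Finset.notMem_empty v hmem
    rw [real_L_eq_zero_of_isolated w A o j ho hw]
    exact measureReal_nonneg
  | succ m ih =>
    intro w hm
    -- pick a positive-weight pair `e = s(o, v)`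
    obtain ⟨v, hv⟩ := Finset.card_pos.1
      (by omega : 0 < (Finset.univ.filter fun v : Fin n => v ≠ o ∧ 0 < (w s(o, v) : ℝ)).card)
    obtain ⟨-, hvo, hvpos⟩ := Finset.mem_filter.1 hv
    set e : Sym2 (Fin n) := s(o, v) with he
    set w₀ : Sym2 (Fin n) → unitInterval := Function.update w e 0 with hw₀
    set w₁ : Sym2 (Fin n) → unitInterval := Function.update w e 1 with hw₁
    -- the count drops by one for `w₀`
    have hcount : (Finset.univ.filter fun u : Fin n => u ≠ o ∧ 0 < (w₀ s(o, u) : ℝ)).card = m := by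
      have hset : (Finset.univ.filter fun u : Fin n => u ≠ o ∧ 0 < (w₀ s(o, u) : ℝ)) =
          (Finset.univ.filter fun u : Fin n => u ≠ o ∧ 0 < (w s(o, u) : ℝ)).erase v := by
        ext u
        simp only [Finset.mem_filter, Finset.mem_univ, true_and, Finset.mem_erase]
        by_cases huv : u = v
        · subst huv
          simp [hw₀, he]
        · have hne : s(o, u) ≠ e := by
            rw [he]
            intro h
            exact huv (Sym2.congr_right.1 h)
          simp [hw₀, Function.update_of_ne hne, huv]
      rw [hset, Finset.card_erase_of_mem hv, hm]
      rfl
    -- induction hypothesis for `w₀`, upgraded to the champion of `w₀`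
    obtain ⟨a₀, ha₀, hCIL₀⟩ := ih w₀ hcount
    obtain ⟨aStar, haStar, hchamp⟩ := exists_champion (prodBernoulli w₀) A hA j
    have hL₀ : (prodBernoulli w₀).real {ω : BondConfig (Fin n) |
        1 ≤ (A.filter fun x => ω ∈ openConn o x).card ∧ (A.filter fun x => ω ∈ openConn o x).card ≤ j} ≤
        (prodBernoulli w₀).real {ω : BondConfig (Fin n) | (A.filter fun x => ω ∈ openConn aStar x).card ≤ j} :=
      hCIL₀.trans (hchamp a₀ ha₀)
    -- merge stability for the gluing `w₀ ↦ w₀[e ↦ 1] = w₁`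
    have hw₀e : w₀ s(o, v) = 0 := by simp [hw₀, he]
    have hMS' := hMS w₀ o v aStar ho hvo haStar hw₀e hchamp
    have hw₁eq : Function.update w₀ s(o, v) 1 = w₁ := by
      rw [hw₀, hw₁, he, Function.update_idem]
    rw [hw₁eq] at hMS'
    -- one-bond decomposition for both events
    refine ⟨aStar, haStar, ?_⟩
    have hp0 : 0 ≤ (w e : ℝ) := (w e).2.1
    have hp1 : (w e : ℝ) ≤ 1 := (w e).2.2
    rw [stub_oneBondDecomp_k15 n w e {ω : BondConfig (Fin n) |
        1 ≤ (A.filter fun x => ω ∈ openConn o x).card ∧ (A.filter fun x => ω ∈ openConn o x).card ≤ j},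
      stub_oneBondDecomp_k15 n w e {ω : BondConfig (Fin n) |
        (A.filter fun x => ω ∈ openConn aStar x).card ≤ j}]
    have h0 : (1 - (w e : ℝ)) * (prodBernoulli w₀).real {ω : BondConfig (Fin n) |
          1 ≤ (A.filter fun x => ω ∈ openConn o x).card ∧ (A.filter fun x => ω ∈ openConn o x).card ≤ j} ≤
        (1 - (w e : ℝ)) * (prodBernoulli w₀).real {ω : BondConfig (Fin n) |
          (A.filter fun x => ω ∈ openConn aStar x).card ≤ j} :=
      mul_le_mul_of_nonneg_left hL₀ (by linarith)
    have h1 : (w e : ℝ) * (prodBernoulli w₁).real {ω : BondConfig (Fin n) |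
          1 ≤ (A.filter fun x => ω ∈ openConn o x).card ∧ (A.filter fun x => ω ∈ openConn o x).card ≤ j} ≤
        (w e : ℝ) * (prodBernoulli w₁).real {ω : BondConfig (Fin n) |
          (A.filter fun x => ω ∈ openConn aStar x).card ≤ j} :=
      mul_le_mul_of_nonneg_left hMS' hp0
    exact add_le_add h0 h1

open ChampionStability in
/-- **CS₂ for one `(n, A, j)` ⇒ MS for `(n, A, j)`.**  Same translation as `mergeStability_of_championStabilityPair`. -/
theorem mergeStability_of_championStabilityPair_at (A : Finset (Fin n)) (j : ℕ)
    (hCS : ∀ (w : Sym2 (Fin n) → unitInterval) (x y c : Fin n), x ∉ A → c ∈ A →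
      (∀ a ∈ A,
        (Literature.Probability.LatticeModels.prodBernoulli w).real {ω : Literature.Probability.Percolation.BondConfig (Fin n) | (A.filter fun z => ω ∈ Literature.Probability.Percolation.openConn a z).card ≤ j} ≤
          (Literature.Probability.LatticeModels.prodBernoulli w).real {ω : Literature.Probability.Percolation.BondConfig (Fin n) | (A.filter fun z => ω ∈ Literature.Probability.Percolation.openConn c z).card ≤ j}) →
      (Literature.Probability.LatticeModels.prodBernoulli w).real {ω : Literature.Probability.Percolation.BondConfig (Fin n) | ω ∉ Literature.Probability.Percolation.openConn c x ∧ ω ∉ Literature.Probability.Percolation.openConn c y ∧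
            1 ≤ (A.filter fun z => ω ∈ Literature.Probability.Percolation.openConn x z ∨ ω ∈ Literature.Probability.Percolation.openConn y z).card ∧
            (A.filter fun z => ω ∈ Literature.Probability.Percolation.openConn x z ∨ ω ∈ Literature.Probability.Percolation.openConn y z).card ≤ j} ≤
        (Literature.Probability.LatticeModels.prodBernoulli w).real {ω : Literature.Probability.Percolation.BondConfig (Fin n) | ω ∉ Literature.Probability.Percolation.openConn c x ∧ ω ∉ Literature.Probability.Percolation.openConn c y ∧
            (A.filter fun z => ω ∈ Literature.Probability.Percolation.openConn c z).card ≤ j}) :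
    ∀ (w : Sym2 (Fin n) → unitInterval) (o v aStar : Fin n),
      o ∉ A → v ≠ o → aStar ∈ A → w s(o, v) = 0 →
      (∀ a ∈ A,
        (Literature.Probability.LatticeModels.prodBernoulli w).real {ω : Literature.Probability.Percolation.BondConfig (Fin n) | (A.filter fun x => ω ∈ Literature.Probability.Percolation.openConn a x).card ≤ j} ≤
          (Literature.Probability.LatticeModels.prodBernoulli w).real {ω : Literature.Probability.Percolation.BondConfig (Fin n) | (A.filter fun x => ω ∈ Literature.Probability.Percolation.openConn aStar x).card ≤ j}) →
      (Literature.Probability.LatticeModels.prodBernoulli (Function.update w s(o, v) 1)).real {ω : Literature.Probability.Percolation.BondConfig (Fin n) |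
            1 ≤ (A.filter fun x => ω ∈ Literature.Probability.Percolation.openConn o x).card ∧ (A.filter fun x => ω ∈ Literature.Probability.Percolation.openConn o x).card ≤ j} ≤
        (Literature.Probability.LatticeModels.prodBernoulli (Function.update w s(o, v) 1)).real {ω : Literature.Probability.Percolation.BondConfig (Fin n) |
            (A.filter fun x => ω ∈ Literature.Probability.Percolation.openConn aStar x).card ≤ j} := by
  intro w o v c ho hvo hc hw hchamp
  have hov : o ≠ v := fun h => hvo h.symm
  set μ₁ := prodBernoulli (Function.update w s(o, v) 1) with hμ₁
  set L₁ : Set (BondConfig (Fin n)) := {ω | 1 ≤ (A.filter fun x => ω ∈ openConn o x).card ∧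
      (A.filter fun x => ω ∈ openConn o x).card ≤ j} with hL₁
  set R₁ : Set (BondConfig (Fin n)) := {ω | (A.filter fun x => ω ∈ openConn c x).card ≤ j} with hR₁
  set C : Set (BondConfig (Fin n)) := openConn o c with hC
  -- split both events along `C = {o ↔ c}`
  have hsplit : ∀ S : Set (BondConfig (Fin n)), μ₁.real S = μ₁.real (S ∩ C) + μ₁.real (S \ C) :=
    fun S => (measureReal_inter_add_sdiff (μ := μ₁) (s := S) (Set.toFinite C).measurableSet).symm
  -- on `C` the two events coincide
  have hLC : L₁ ∩ C = R₁ ∩ C := by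
    ext ω
    simp only [hL₁, hR₁, hC, mem_inter_iff, mem_setOf_eq]
    constructor
    · rintro ⟨⟨-, h2⟩, hoc⟩
      have hoc' : (openGraph ω).Reachable o c := hoc
      have heq : (A.filter fun x => ω ∈ openConn c x) = (A.filter fun x => ω ∈ openConn o x) := by
        refine Finset.filter_congr fun x _ => ⟨fun h => ?_, fun h => ?_⟩
        · exact hoc'.trans h
        · exact hoc'.symm.trans h
      rw [heq]
      exact ⟨h2, hoc⟩
    · rintro ⟨h2, hoc⟩
      have hoc' : (openGraph ω).Reachable o c := hoc
      have heq : (A.filter fun x => ω ∈ openConn o x) = (A.filter fun x => ω ∈ openConn c x) := by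
        refine Finset.filter_congr fun x _ => ⟨fun h => ?_, fun h => ?_⟩
        · exact hoc'.symm.trans h
        · exact hoc'.trans h
      rw [heq]
      refine ⟨⟨Finset.card_pos.2 ⟨c, Finset.mem_filter.2 ⟨hc, ?_⟩⟩, h2⟩, hoc⟩
      exact SimpleGraph.Reachable.refl c
  -- off `C`, pull back to `μ_w` and identify with the two events of CS₂
  have hLoff : μ₁.real (L₁ \ C) = (prodBernoulli w).real {ω : BondConfig (Fin n) |
      ω ∉ openConn c o ∧ ω ∉ openConn c v ∧
      1 ≤ (A.filter fun z => ω ∈ openConn o z ∨ ω ∈ openConn v z).card ∧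
      (A.filter fun z => ω ∈ openConn o z ∨ ω ∈ openConn v z).card ≤ j} := by
    rw [hμ₁, real_update_one_eq w hw]
    congr 1
    ext ω
    simp only [hL₁, hC, mem_preimage, mem_sdiff, mem_setOf_eq]
    have hfilt : (A.filter fun x => insert s(o, v) ω ∈ openConn o x) =
        (A.filter fun z => ω ∈ openConn o z ∨ ω ∈ openConn v z) := by
      refine Finset.filter_congr fun x _ => ?_
      exact reachable_insert_left_iff ω hov x
    have hco : insert s(o, v) ω ∈ openConn o c ↔ (ω ∈ openConn c o ∨ ω ∈ openConn c v) := by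
      show (openGraph (insert s(o, v) ω)).Reachable o c ↔
        ((openGraph ω).Reachable c o ∨ (openGraph ω).Reachable c v)
      rw [SimpleGraph.reachable_comm]
      exact reachable_insert_to_left_iff ω hov c
    rw [hfilt, hco]
    tauto
  have hRoff : μ₁.real (R₁ \ C) = (prodBernoulli w).real {ω : BondConfig (Fin n) |
      ω ∉ openConn c o ∧ ω ∉ openConn c v ∧ (A.filter fun z => ω ∈ openConn c z).card ≤ j} := by
    rw [hμ₁, real_update_one_eq w hw]
    congr 1
    ext ω
    simp only [hR₁, hC, mem_preimage, mem_sdiff, mem_setOf_eq]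
    have hco : insert s(o, v) ω ∈ openConn o c ↔ (ω ∈ openConn c o ∨ ω ∈ openConn c v) := by
      show (openGraph (insert s(o, v) ω)).Reachable o c ↔
        ((openGraph ω).Reachable c o ∨ (openGraph ω).Reachable c v)
      rw [SimpleGraph.reachable_comm]
      exact reachable_insert_to_left_iff ω hov c
    rw [hco]
    constructor
    · rintro ⟨hcard, hnot⟩
      have hco' : ¬ (openGraph ω).Reachable c o := fun h => hnot (Or.inl h)
      have hcv' : ¬ (openGraph ω).Reachable c v := fun h => hnot (Or.inr h)
      have hfilt : (A.filter fun x => insert s(o, v) ω ∈ openConn c x) =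
          (A.filter fun z => ω ∈ openConn c z) := by
        refine Finset.filter_congr fun x _ => ?_
        exact reachable_insert_iff_of_not ω hov hco' hcv' x
      rw [hfilt] at hcard
      exact ⟨hco', hcv', hcard⟩
    · rintro ⟨hco', hcv', hcard⟩
      have hfilt : (A.filter fun x => insert s(o, v) ω ∈ openConn c x) =
          (A.filter fun z => ω ∈ openConn c z) := by
        refine Finset.filter_congr fun x _ => ?_
        exact reachable_insert_iff_of_not ω hov hco' hcv' x
      rw [hfilt]
      exact ⟨hcard, fun h => h.elim hco' hcv'⟩
  have key := hCS w o v c ho hc hchamp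
  rw [hsplit L₁, hsplit R₁, hLC, hLoff, hRoff]
  linarith

/-- **CS₂ for one `(n, A, j)` ⇒ CIL_j for `A`.** -/
theorem cumulativeIsolation_of_championStabilityPair_at (A : Finset (Fin n)) (j : ℕ)
    (hCS : ∀ (w : Sym2 (Fin n) → unitInterval) (x y c : Fin n), x ∉ A → c ∈ A →
      (∀ a ∈ A,
        (Literature.Probability.LatticeModels.prodBernoulli w).real {ω : Literature.Probability.Percolation.BondConfig (Fin n) | (A.filter fun z => ω ∈ Literature.Probability.Percolation.openConn a z).card ≤ j} ≤
          (Literature.Probability.LatticeModels.prodBernoulli w).real {ω : Literature.Probability.Percolation.BondConfig (Fin n) | (A.filter fun z => ω ∈ Literature.Probability.Percolation.openConn c z).card ≤ j}) →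
      (Literature.Probability.LatticeModels.prodBernoulli w).real {ω : Literature.Probability.Percolation.BondConfig (Fin n) | ω ∉ Literature.Probability.Percolation.openConn c x ∧ ω ∉ Literature.Probability.Percolation.openConn c y ∧
            1 ≤ (A.filter fun z => ω ∈ Literature.Probability.Percolation.openConn x z ∨ ω ∈ Literature.Probability.Percolation.openConn y z).card ∧
            (A.filter fun z => ω ∈ Literature.Probability.Percolation.openConn x z ∨ ω ∈ Literature.Probability.Percolation.openConn y z).card ≤ j} ≤
        (Literature.Probability.LatticeModels.prodBernoulli w).real {ω : Literature.Probability.Percolation.BondConfig (Fin n) | ω ∉ Literature.Probability.Percolation.openConn c x ∧ ω ∉ Literature.Probability.Percolation.openConn c y ∧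
            (A.filter fun z => ω ∈ Literature.Probability.Percolation.openConn c z).card ≤ j}) :
    ∀ (w : Sym2 (Fin n) → unitInterval) (o : Fin n), A.Nonempty → o ∉ A → ∃ a ∈ A,
        (Literature.Probability.LatticeModels.prodBernoulli w).real {ω : Literature.Probability.Percolation.BondConfig (Fin n) |
              1 ≤ (A.filter fun x => ω ∈ Literature.Probability.Percolation.openConn o x).card ∧ (A.filter fun x => ω ∈ Literature.Probability.Percolation.openConn o x).card ≤ j} ≤
          (Literature.Probability.LatticeModels.prodBernoulli w).real {ω : Literature.Probability.Percolation.BondConfig (Fin n) | (A.filter fun x => ω ∈ Literature.Probability.Percolation.openConn a x).card ≤ j} :=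
  cumulativeIsolation_of_mergeStability_at A j (mergeStability_of_championStabilityPair_at A j hCS)

/-- **The `|A| = 5` rung.**  Champion stability for vertex pairs for a five-element relay set at level `2` gives the cumulative
isolation lemma for that relay set at every level `j` (levels `0`: empty event; `1`: `cumulativeIsolation_level_one` (lonely relay);
`2`: the hypothesis via `cumulativeIsolation_of_championStabilityPair_at`; `≥ 3 = |A| − 2`: `cumulativeIsolation_level_ge_card_sub_two`). -/
theorem cumulativeIsolation_card_five_of_championStabilityPair (A : Finset (Fin n)) (hA5 : A.card = 5)
    (hCS : ∀ (w : Sym2 (Fin n) → unitInterval) (x y c : Fin n), x ∉ A → c ∈ A →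
      (∀ a ∈ A,
        (Literature.Probability.LatticeModels.prodBernoulli w).real {ω : Literature.Probability.Percolation.BondConfig (Fin n) | (A.filter fun z => ω ∈ Literature.Probability.Percolation.openConn a z).card ≤ 2} ≤
          (Literature.Probability.LatticeModels.prodBernoulli w).real {ω : Literature.Probability.Percolation.BondConfig (Fin n) | (A.filter fun z => ω ∈ Literature.Probability.Percolation.openConn c z).card ≤ 2}) →
      (Literature.Probability.LatticeModels.prodBernoulli w).real {ω : Literature.Probability.Percolation.BondConfig (Fin n) | ω ∉ Literature.Probability.Percolation.openConn c x ∧ ω ∉ Literature.Probability.Percolation.openConn c y ∧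
            1 ≤ (A.filter fun z => ω ∈ Literature.Probability.Percolation.openConn x z ∨ ω ∈ Literature.Probability.Percolation.openConn y z).card ∧
            (A.filter fun z => ω ∈ Literature.Probability.Percolation.openConn x z ∨ ω ∈ Literature.Probability.Percolation.openConn y z).card ≤ 2} ≤
        (Literature.Probability.LatticeModels.prodBernoulli w).real {ω : Literature.Probability.Percolation.BondConfig (Fin n) | ω ∉ Literature.Probability.Percolation.openConn c x ∧ ω ∉ Literature.Probability.Percolation.openConn c y ∧
            (A.filter fun z => ω ∈ Literature.Probability.Percolation.openConn c z).card ≤ 2}) :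
    ∀ (w : Sym2 (Fin n) → unitInterval) (o : Fin n) (j : ℕ), o ∉ A → ∃ a ∈ A,
        (Literature.Probability.LatticeModels.prodBernoulli w).real {ω : Literature.Probability.Percolation.BondConfig (Fin n) |
              1 ≤ (A.filter fun x => ω ∈ Literature.Probability.Percolation.openConn o x).card ∧ (A.filter fun x => ω ∈ Literature.Probability.Percolation.openConn o x).card ≤ j} ≤
          (Literature.Probability.LatticeModels.prodBernoulli w).real {ω : Literature.Probability.Percolation.BondConfig (Fin n) | (A.filter fun x => ω ∈ Literature.Probability.Percolation.openConn a x).card ≤ j} := by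
  intro w o j ho
  have hA : A.Nonempty := Finset.card_pos.1 (by omega)
  rcases Nat.lt_or_ge j 1 with hj0 | hj1
  · obtain ⟨a, ha⟩ := hA
    refine ⟨a, ha, ?_⟩
    have hempty : {ω : BondConfig (Fin n) |
        1 ≤ (A.filter fun x => ω ∈ openConn o x).card ∧
          (A.filter fun x => ω ∈ openConn o x).card ≤ j} = ∅ := by
      ext ω; simp only [mem_setOf_eq, mem_empty_iff_false, iff_false]; omega
    rw [hempty, measureReal_empty]
    exact measureReal_nonneg
  rcases Nat.lt_or_ge j 2 with hj2 | hj2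
  · have hj : j = 1 := by omega
    subst hj
    exact cumulativeIsolation_level_one w A o hA
  rcases Nat.lt_or_ge j 3 with hj3 | hj3
  · have hj : j = 2 := by omega
    subst hj
    exact cumulativeIsolation_of_championStabilityPair_at A 2 hCS w o hA ho
  · exact cumulativeIsolation_level_ge_card_sub_two n w A o j (by omega) hA

end Summit.CriticalPhenomena.PercolationContinuityZ3.Theorems

end
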